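import Mathlib
import Summits.NavierStokesRegularity.NavierStokesRegularity.Theorems.EulerZoomLiouvilleSereginZoomReductionPairingModulus
import HarnessLib

/-!
# Strong `L²` compactness of the velocities of distributional Navier–Stokes solutions with VARYING
# viscosities `ν_k ∈ [-1, 1]` on a cylinder (support item `EulerZoomLiouville.SereginZoomReduction` = stmt-19834)

Route `EulerZoomLiouville` (NavierStokesRegularity), support item Z = Seregin's Euler-zoom theorem (Seregin 2026
Thm 3.1 = Seregin 2023 Prop 1.2 at `(s,l,κ) = (3,3,2)`, `f(r) = r^ρ`).  The Euler-zoomed sequence solves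
Navier–Stokes with viscosities `ν_k = λ_k^ρ → 0`, so the tree's `NSCylinder.exists_subseq_strong_limit_velocity`
(`ν = 1`; Lin 1998 Thm 2.2, Bradshaw–Tsai 2019 §4.3, Lemarié-Rieusset 2016 Thm 12.1) does not apply verbatim.
This file is its twin for a sequence `(v_k, π_k)` of distributional solutions with viscosities `|ν_k| ≤ 1` on
`W = (a,b) × Ω` (`Ω` a bounded Lipschitz domain, e.g. a ball) with the three uniform bounds
`∫_Ω ‖v_k(t)‖² ≤ C` (a.e. `t`), `∫∫_W |∇v_k|² ≤ C_g`, `∫∫_W |π_k|^{3/2} ≤ C_p`: a subsequence converges STRONGLY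
in `L²(W)` (and slice-wise against test functions for a.e. `t`) to a jointly measurable `u` with
`∫_Ω ‖u(t)‖² ≤ C` — `exists_subseq_strong_limit_velocity_visc`, `exists_subseq_strong_limit_velocity_visc_ball`.
Proof: the `ν`-uniform modulus `exists_fullMeasure_pairing_modulus_visc` and the generic Aubin–Lions theorem
`AubinLions.exists_subseq_strong_limit_of_equicontinuous` (Ehrling + Rellich–Kondrachov), exactly as in the
`ν = 1` file.  WHAT THIS IS NOT: not NS regularity, not the crux; a helper `--supports` stmt-19834. [folklore]
-/

noncomputable section

set_option linter.dupNamespace false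

open MeasureTheory TopologicalSpace Set Function Filter Topology Metric Bornology intervalIntegral
open scoped NNReal ENNReal InnerProductSpace RealInnerProductSpace Laplacian

namespace Summit.NavierStokesRegularity.NavierStokesRegularity.Theorems.SereginZoomReduction

open Literature.Analysis Literature.Analysis.FluidPDE Literature.Analysis.FunctionSpaces

/-- **Strong `L²` compactness of the velocities on a cylinder, viscosities `|ν_k| ≤ 1`.**  Let `Ω ⊆ ℝ³`
be a bounded Lipschitz domain and `(v_k, π_k)` distributional solutions of Navier–Stokes with viscosity
`ν_k`, `|ν_k| ≤ 1`, no force, on `W = (a, b) × Ω`, with uniformly in `k`: `∫_Ω ‖v_k(t)‖² ≤ C` for a.e.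
`t ∈ (a,b)`, weak spatial gradients with `∫∫_W |∇v_k|² ≤ C_g`, and `∫∫_W |π_k|^{3/2} ≤ C_p`.  Then a
subsequence `v_{σ i}` converges strongly in `L²(W)` to a jointly measurable `u` with `∫_Ω ‖u(t)‖² ≤ C` for
a.e. `t`, and the slice pairings `∫_Ω φ • v_{σ i}(t)` converge to `∫_Ω φ • u(t)` for a.e. `t`, for every
test function `φ` on `Ω` (the `ν`-uniform twin of `NSCylinder.exists_subseq_strong_limit_velocity`).
[folklore] -/
theorem exists_subseq_strong_limit_velocity_visc {Ω : Opens (EuclideanSpace ℝ (Fin 3))}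
    (hΩ : FunctionSpaces.IsLipschitzDomain Ω) (hbΩ : IsBounded (Ω : Set (EuclideanSpace ℝ (Fin 3)))) {a b : ℝ}
    {ν : ℕ → ℝ} (hν : ∀ k, |ν k| ≤ 1)
    {v : ℕ → ℝ → (EuclideanSpace ℝ (Fin 3)) → (EuclideanSpace ℝ (Fin 3))}
    {π : ℕ → ℝ → (EuclideanSpace ℝ (Fin 3)) → ℝ} {C Cg Cp : ℝ≥0∞}
    (hC : C ≠ ⊤) (hCg : Cg ≠ ⊤) (hCp : Cp ≠ ⊤)
    (hsol : ∀ k, IsDistributionalNSSolutionOn (timeCylinder Ω a b) (ν k) 0 (v k) (π k))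
    (hE : ∀ k, ∀ᵐ t ∂(volume.restrict (Ioo a b)),
      ∫⁻ x in (Ω : Set (EuclideanSpace ℝ (Fin 3))), ‖v k t x‖ₑ ^ 2 ≤ C)
    (hG : ∀ k, ∃ G : ℝ → (EuclideanSpace ℝ (Fin 3)) → (EuclideanSpace ℝ (Fin 3)) →L[ℝ] (EuclideanSpace ℝ (Fin 3)),
      HasWeakSpatialGradientOn (timeCylinder Ω a b) (v k) G ∧
      ∫⁻ z in Ioo a b ×ˢ (Ω : Set (EuclideanSpace ℝ (Fin 3))), ENNReal.ofReal (frobeniusNormSq (G z.1 z.2)) ≤ Cg)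
    (hP : ∀ k, ∫⁻ z in Ioo a b ×ˢ (Ω : Set (EuclideanSpace ℝ (Fin 3))), ‖π k z.1 z.2‖ₑ ^ (3 / 2 : ℝ) ≤ Cp) :
    ∃ (σ : ℕ → ℕ) (u : ℝ → (EuclideanSpace ℝ (Fin 3)) → (EuclideanSpace ℝ (Fin 3))), StrictMono σ ∧
      AEStronglyMeasurable (uncurry u) (volume.restrict (Ioo a b ×ˢ (Ω : Set (EuclideanSpace ℝ (Fin 3))))) ∧
      (∀ᵐ t ∂(volume.restrict (Ioo a b)), ∫⁻ x in (Ω : Set (EuclideanSpace ℝ (Fin 3))), ‖u t x‖ₑ ^ 2 ≤ C) ∧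
      Tendsto (fun i => ∫⁻ z in Ioo a b ×ˢ (Ω : Set (EuclideanSpace ℝ (Fin 3))),
        ‖v (σ i) z.1 z.2 - u z.1 z.2‖ₑ ^ 2) atTop (𝓝 0) ∧
      ∀ φ : (EuclideanSpace ℝ (Fin 3)) → ℝ, FunctionSpaces.IsTestFunctionOn Ω φ →
        ∀ᵐ t ∂(volume.restrict (Ioo a b)),
          Tendsto (fun i => ∫ x in (Ω : Set (EuclideanSpace ℝ (Fin 3))), φ x • v (σ i) t x) atTop
            (𝓝 (∫ x in (Ω : Set (EuclideanSpace ℝ (Fin 3))), φ x • u t x)) := by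
  haveI : IsFiniteMeasure ((volume : Measure (EuclideanSpace ℝ (Fin 3))).restrict
      (Ω : Set (EuclideanSpace ℝ (Fin 3)))) := ⟨by
    rw [Measure.restrict_apply_univ]
    exact (measure_mono subset_closure).trans_lt hbΩ.isCompact_closure.measure_lt_top⟩
  -- measurability and the gradient hypotheses
  have hvm : ∀ k, AEStronglyMeasurable (uncurry (v k))
      (volume.restrict (Ioo a b ×ˢ (Ω : Set (EuclideanSpace ℝ (Fin 3))))) :=
    fun k => (hsol k).1.aestronglyMeasurable
  choose G hGw hGb using hG
  have hGm : ∀ k, AEStronglyMeasurable (uncurry (G k))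
      (volume.restrict (Ioo a b ×ˢ (Ω : Set (EuclideanSpace ℝ (Fin 3))))) :=
    fun k => (hGw k).locallyIntegrableOn_grad.aestronglyMeasurable
  have hGs : ∀ k, ∀ᵐ t ∂(volume.restrict (Ioo a b)),
      FunctionSpaces.HasWeakFDerivOn Ω volume (v k t) (G k t) :=
    fun k => (hGw k).ae_hasWeakFDerivOn_slice
  have hGb' : ∀ k, ∫⁻ z in Ioo a b ×ˢ (Ω : Set (EuclideanSpace ℝ (Fin 3))), ‖G k z.1 z.2‖ₑ ^ 2 ≤ Cg :=
    fun k => NSCylinder.lintegral_enorm_sq_le_of_frobenius (hGb k)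
  -- equicontinuity of the pairings
  have hEC : ∀ φ : (EuclideanSpace ℝ (Fin 3)) → ℝ, FunctionSpaces.IsTestFunctionOn Ω φ →
      ∃ ω : ℝ → ℝ, Tendsto ω (𝓝 0) (𝓝 0) ∧
        ∀ k, ∃ S : Set ℝ, (∀ᵐ t ∂(volume.restrict (Ioo a b)), t ∈ S) ∧
          ∀ t ∈ S, ∀ s ∈ S, ‖(∫ x in (Ω : Set (EuclideanSpace ℝ (Fin 3))), φ x • v k t x) -
            ∫ x in (Ω : Set (EuclideanSpace ℝ (Fin 3))), φ x • v k s x‖ ≤ ω (t - s) := by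
    intro φ hφ
    have hη : ∀ i, FunctionSpaces.IsTestFunctionOn Ω
        (fun x => φ x • EuclideanSpace.basisFun (Fin 3) ℝ i) := fun i =>
      NSCylinder.isTestFunctionOn_smul_const hφ _
    choose K₀ K₁ K₂ hK₀ hK₁ hK₂ using fun i => exists_bounds_of_isTestFunctionOn (hη i)
    -- the modulus
    obtain ⟨A, hA⟩ : ∃ A : Fin 3 → ℝ, A = fun i =>
        K₁ i * C.toReal + K₂ i * ((volume (Ω : Set (EuclideanSpace ℝ (Fin 3)))).toReal + C.toReal) :=
      ⟨_, rfl⟩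
    obtain ⟨B, hB⟩ : ∃ B : Fin 3 → ℝ, B = fun i => 3 * K₁ i *
        (((volume (Ω : Set (EuclideanSpace ℝ (Fin 3)))) ^ (1 / 2 : ℝ) * Cp) ^ (2 / 3 : ℝ)).toReal :=
      ⟨_, rfl⟩
    refine ⟨fun δ => ∑ i, (A i * |δ| + B i * |δ| ^ (1 / 3 : ℝ)), ?_, fun k => ?_⟩
    · have hc : Continuous fun δ : ℝ => ∑ i, (A i * |δ| + B i * |δ| ^ (1 / 3 : ℝ)) :=
        continuous_finsetSum _ fun i _ => (continuous_const.mul continuous_abs).add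
          (continuous_const.mul (continuous_abs.rpow_const fun _ => Or.inr (by norm_num)))
      have h0 := hc.tendsto 0
      simpa [Real.zero_rpow (by norm_num : (1 / 3 : ℝ) ≠ 0)] using h0
    -- the good set for the `k`-th solution
    choose S hSae hS using fun i => exists_fullMeasure_pairing_modulus_visc (hν k) (hsol k) hbΩ
      hC hCp (hE k) (hP k) (hη i) (hK₁ i) (hK₂ i)
    have hslice := FunctionSpaces.AubinLions.ae_aestronglyMeasurable_slice (hvm k)
    refine ⟨{t | (∀ i, t ∈ S i) ∧
        AEStronglyMeasurable (v k t) (volume.restrict (Ω : Set (EuclideanSpace ℝ (Fin 3)))) ∧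
        ∫⁻ x in (Ω : Set (EuclideanSpace ℝ (Fin 3))), ‖v k t x‖ₑ ^ 2 ≤ C}, ?_, ?_⟩
    · have hall : ∀ᵐ t ∂(volume.restrict (Ioo a b)), ∀ i, t ∈ S i := ae_all_iff.2 hSae
      filter_upwards [hall, hslice, hE k] with t h1 h2 h3
      exact ⟨h1, h2, h3⟩
    rintro t ⟨htS, htm, htE⟩ s ⟨hsS, hsm, hsE⟩
    have hit : Integrable (fun x => φ x • v k t x) (volume.restrict (Ω : Set (EuclideanSpace ℝ (Fin 3)))) :=
      FunctionSpaces.Ehrling.integrable_smul_of_memLp_two hφ (NSCylinder.memLp_two_slice hC htm htE)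
    have his : Integrable (fun x => φ x • v k s x) (volume.restrict (Ω : Set (EuclideanSpace ℝ (Fin 3)))) :=
      FunctionSpaces.Ehrling.integrable_smul_of_memLp_two hφ (NSCylinder.memLp_two_slice hC hsm hsE)
    calc ‖(∫ x in (Ω : Set (EuclideanSpace ℝ (Fin 3))), φ x • v k t x) -
          ∫ x in (Ω : Set (EuclideanSpace ℝ (Fin 3))), φ x • v k s x‖
        ≤ ∑ i, |⟪(∫ x in (Ω : Set (EuclideanSpace ℝ (Fin 3))), φ x • v k t x) -
            ∫ x in (Ω : Set (EuclideanSpace ℝ (Fin 3))), φ x • v k s x,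
            EuclideanSpace.basisFun (Fin 3) ℝ i⟫| := norm_le_sum_abs_inner_basisFun _
      _ = ∑ i, |(∫ x in (Ω : Set (EuclideanSpace ℝ (Fin 3))),
              ⟪v k t x, φ x • EuclideanSpace.basisFun (Fin 3) ℝ i⟫) -
            ∫ x in (Ω : Set (EuclideanSpace ℝ (Fin 3))),
              ⟪v k s x, φ x • EuclideanSpace.basisFun (Fin 3) ℝ i⟫| := by
          refine Finset.sum_congr rfl fun i _ => ?_
          rw [inner_sub_left, NSCylinder.inner_integral_smul_eq hit,
            NSCylinder.inner_integral_smul_eq his]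
      _ ≤ ∑ i, (A i * |t - s| + B i * |t - s| ^ (1 / 3 : ℝ)) := by
          refine Finset.sum_le_sum fun i _ => ?_
          have h := hS i t (htS i) s (hsS i)
          rw [hA, hB]
          linarith [h]
  -- the abstract compactness theorem
  obtain ⟨σ, u, hσ, hum, huE, hus, huP⟩ :=
    FunctionSpaces.AubinLions.exists_subseq_strong_limit_of_equicontinuous (F := (EuclideanSpace ℝ (Fin 3)))
      hΩ hbΩ hC hCg hvm hE hGm hGs hGb' hEC
  exact ⟨σ, u, hσ, hum, huE, hus, huP⟩

/-- **Strong `L²` compactness of the velocities on `(a, b) × B(x₀, R)`, viscosities `|ν_k| ≤ 1`**: the case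
of a ball (balls are bounded Lipschitz domains, `isLipschitzDomain_ball`) of
`exists_subseq_strong_limit_velocity_visc`. [folklore] -/
theorem exists_subseq_strong_limit_velocity_visc_ball (x₀ : (EuclideanSpace ℝ (Fin 3))) (R : ℝ) {a b : ℝ}
    {ν : ℕ → ℝ} (hν : ∀ k, |ν k| ≤ 1)
    {v : ℕ → ℝ → (EuclideanSpace ℝ (Fin 3)) → (EuclideanSpace ℝ (Fin 3))}
    {π : ℕ → ℝ → (EuclideanSpace ℝ (Fin 3)) → ℝ} {C Cg Cp : ℝ≥0∞}
    (hC : C ≠ ⊤) (hCg : Cg ≠ ⊤) (hCp : Cp ≠ ⊤)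
    (hsol : ∀ k, IsDistributionalNSSolutionOn
      (timeCylinder (⟨ball x₀ R, isOpen_ball⟩ : Opens (EuclideanSpace ℝ (Fin 3))) a b) (ν k) 0 (v k) (π k))
    (hE : ∀ k, ∀ᵐ t ∂(volume.restrict (Ioo a b)), ∫⁻ x in ball x₀ R, ‖v k t x‖ₑ ^ 2 ≤ C)
    (hG : ∀ k, ∃ G : ℝ → (EuclideanSpace ℝ (Fin 3)) → (EuclideanSpace ℝ (Fin 3)) →L[ℝ] (EuclideanSpace ℝ (Fin 3)),
      HasWeakSpatialGradientOn
        (timeCylinder (⟨ball x₀ R, isOpen_ball⟩ : Opens (EuclideanSpace ℝ (Fin 3))) a b) (v k) G ∧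
      ∫⁻ z in Ioo a b ×ˢ ball x₀ R, ENNReal.ofReal (frobeniusNormSq (G z.1 z.2)) ≤ Cg)
    (hP : ∀ k, ∫⁻ z in Ioo a b ×ˢ ball x₀ R, ‖π k z.1 z.2‖ₑ ^ (3 / 2 : ℝ) ≤ Cp) :
    ∃ (σ : ℕ → ℕ) (u : ℝ → (EuclideanSpace ℝ (Fin 3)) → (EuclideanSpace ℝ (Fin 3))), StrictMono σ ∧
      AEStronglyMeasurable (uncurry u) (volume.restrict (Ioo a b ×ˢ ball x₀ R)) ∧
      (∀ᵐ t ∂(volume.restrict (Ioo a b)), ∫⁻ x in ball x₀ R, ‖u t x‖ₑ ^ 2 ≤ C) ∧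
      Tendsto (fun i => ∫⁻ z in Ioo a b ×ˢ ball x₀ R, ‖v (σ i) z.1 z.2 - u z.1 z.2‖ₑ ^ 2)
        atTop (𝓝 0) ∧
      ∀ φ : (EuclideanSpace ℝ (Fin 3)) → ℝ,
        FunctionSpaces.IsTestFunctionOn (⟨ball x₀ R, isOpen_ball⟩ : Opens (EuclideanSpace ℝ (Fin 3))) φ →
        ∀ᵐ t ∂(volume.restrict (Ioo a b)),
          Tendsto (fun i => ∫ x in ball x₀ R, φ x • v (σ i) t x) atTop
            (𝓝 (∫ x in ball x₀ R, φ x • u t x)) :=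
  exists_subseq_strong_limit_velocity_visc (Ω := (⟨ball x₀ R, isOpen_ball⟩ : Opens (EuclideanSpace ℝ (Fin 3))))
    (FunctionSpaces.isLipschitzDomain_ball x₀ R) isBounded_ball hν hC hCg hCp hsol hE hG hP

end Summit.NavierStokesRegularity.NavierStokesRegularity.Theorems.SereginZoomReduction
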